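import Summits.BirchSwinnertonDyer.BirchSwinnertonDyer.Theorems.EdixhovenFibreFiveSevenManinSideOfCDTInt
import Summits.BirchSwinnertonDyer.BirchSwinnertonDyer.Theses.TeichmullerTwistDescent
import HarnessLib

/-!
# Route `TeichmullerTwistDescent`: its SEVEN Manin-side declarations — PSMU (22638), SCMU57 (22639), CORNER (23883), LOW (23884), WILD (24306),
# TAME (24307), GE11 (23885) — MODULO THE PRINTED CALEGARI–DIMITROV–TANG **THEOREM 1 VERBATIM** (integer coefficients), not Remarks 58–59 —
# cross-route `--supports` (stmt-BirchSwinnertonDyer-22638)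

Cell `pub/bsd-wall`, seat `bsd-line-edix-p1` g36 (LEAD lineage of the EdixhovenFibreFiveSeven line `kato-lever`; cross-route helper, announced on
STATUS; no seat holds these items — the base `bsd-line-ttd-p1` is SUMMON-only and recorded «plain-Thm-1 keyed wrappers NOT landed» at g31).
THEOREMS ONLY (no definition, no named fact, no instance, no `sorry`); nothing is closed by name; BSD is not proved; Manin's conjecture is not proved;
no Manin theorem is announced.

WHAT THIS FILE DOES. The Theorem-1 twin of `TeichmullerTwistDescent.*_of_CDT` (ttd-p1 g31, p769544): each of the seven decls carries a LATTICE-OPTIMAL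
datum of a globally minimal curve ADDITIVE at a prime `p ≥ 5`, so each is ONE line over `EdixhovenFibreFiveSevenOfCDTInt.not_dvd_c_of_CDTInt`
(p811415: `p ∤ c(D)` at every such datum, any level, modulo `CalegariDimitrovTang2025_unboundedDenominators` = Theorem 1 of the paper AS PRINTED,
via the cell bsd-f2-manin's integer chain `ManinLocalTwoThree.CDivisionInt.abs_maninConstant_eq_one_of_CDTInt_of_odd_sq_dvd`); all other clauses of
the decls are idle. `maninSide_of_CDTInt` is the seven-fold conjunction — the Theorem-1 twin of the closed conditional-record item `ManinSideOfCDT`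
(stmt-BirchSwinnertonDyer-32257, `_algInt → …`). Since `CalegariDimitrovTang2025_unboundedDenominators_of_algInt : …_algInt → …`, every theorem below
is STRONGER than its p769544 twin.

HONEST STATUS: CONDITIONAL on the cite-only printed fact `Literature.NumberTheory.Automorphic.CalegariDimitrovTang2025_unboundedDenominators`
(J. Amer. Math. Soc. 38 (2025), Theorem 1; statement-only in the tree); the seven items stay OPEN by name. BSD is not proved by this.
[cite: CalegariDimitrovTang2025, Thm. 1] [cite: LingOesterle1991, Thm. 6] [cite: KostersPannekoek2017, Thm. 1 and Cor. 2]
[cite: EdixhovenManin1991, Thm. 3] [cite: AgasheRibetStein2006, Thm. 2.7]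
-/

set_option autoImplicit false
-- single-conjunct summit: `Summit.BirchSwinnertonDyer.BirchSwinnertonDyer.…` repeats the name by design
set_option linter.dupNamespace false

noncomputable section

open scoped Classical

open WeierstrassCurve Literature.NumberTheory.EllipticCurves Literature.NumberTheory.EllipticCurves.ModularForms
  Literature.NumberTheory.EllipticCurves.Rank1Residual Literature.NumberTheory.Automorphic
  Summit.BirchSwinnertonDyer.BirchSwinnertonDyer.Theses.TeichmullerTwistDescent
  Summit.BirchSwinnertonDyer.BirchSwinnertonDyer.Theorems
  Summit.BirchSwinnertonDyer.BirchSwinnertonDyer.Theorems.EdixhovenFibreFiveSevenOfCDTInt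

namespace Summit.BirchSwinnertonDyer.BirchSwinnertonDyer.Theorems.TeichmullerTwistDescentOfCDTInt

/-- **PSMU `PrincipalSeriesOptimalManinUnit` (stmt-BirchSwinnertonDyer-22638) ⟸ CDT THEOREM 1** (the `Irr`, (G)-ordinary-member and `Iₙ*`-free-member
clauses are idle). CONDITIONAL; the item is not closed by this; BSD is not proved by this. [cite: CalegariDimitrovTang2025, Thm. 1] -/
theorem principalSeriesOptimalManinUnit_of_CDTInt (hCDT : CalegariDimitrovTang2025_unboundedDenominators) :
    PrincipalSeriesOptimalManinUnit := by
  intro W _ _ p _ N _ D hp5 hadd _hirr _hG _hI hlat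
  exact not_dvd_c_of_CDTInt hCDT D hp5 hadd hlat

/-- **SCMU57 `SupercuspidalOptimalManinUnitFiveSeven` (stmt-BirchSwinnertonDyer-22639) ⟸ CDT THEOREM 1** (class clauses idle). CONDITIONAL; the item
is not closed by this; BSD is not proved by this. [cite: CalegariDimitrovTang2025, Thm. 1] -/
theorem supercuspidalOptimalManinUnitFiveSeven_of_CDTInt (hCDT : CalegariDimitrovTang2025_unboundedDenominators) :
    SupercuspidalOptimalManinUnitFiveSeven := by
  intro W _ _ p _ N _ D hp57 hadd _hirr _hnoG _hI hlat
  have hp5 : 5 ≤ p := by rcases hp57 with rfl | rfl <;> omega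
  exact not_dvd_c_of_CDTInt hCDT D hp5 hadd hlat

/-- **CORNER `KummerCornerTorsionOptimalManinUnit` (stmt-BirchSwinnertonDyer-23883; shared verbatim with EdixhovenFibreFiveSeven) ⟸ CDT THEOREM 1**
(all cell clauses idle). CONDITIONAL; the item is not closed by this; BSD is not proved by this. [cite: CalegariDimitrovTang2025, Thm. 1]
[cite: KostersPannekoek2017, Thm. 1 and Cor. 2 (the corner)] -/
theorem kummerCornerTorsionOptimalManinUnit_of_CDTInt (hCDT : CalegariDimitrovTang2025_unboundedDenominators) :
    KummerCornerTorsionOptimalManinUnit := by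
  intro W _ _ p _ _ D hcell hadd _hirr _hord _htor hlat
  have hp5 : 5 ≤ p := by rcases hcell with ⟨rfl, _⟩ | ⟨rfl, _⟩ <;> omega
  exact not_dvd_c_of_CDTInt hCDT D hp5 hadd hlat

/-- **LOW `SupersingularTorsionOptimalManinUnitFive` (stmt-BirchSwinnertonDyer-23884; shared verbatim with EdixhovenFibreFiveSeven) ⟸ CDT THEOREM 1**
(clauses idle). CONDITIONAL; the item is not closed by this; BSD is not proved by this. [cite: CalegariDimitrovTang2025, Thm. 1] [cite: KostersPannekoek2017, Thm. 1] -/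
theorem supersingularTorsionOptimalManinUnitFive_of_CDTInt (hCDT : CalegariDimitrovTang2025_unboundedDenominators) :
    SupersingularTorsionOptimalManinUnitFive := by
  intro W _ _ p _ _ D hcell hadd _hirr _hnoG _htor hlat
  have hp5 : 5 ≤ p := by rcases hcell with ⟨rfl, _⟩ | ⟨rfl, _⟩ <;> omega
  exact not_dvd_c_of_CDTInt hCDT D hp5 hadd hlat

/-- **WILD `KummerCornerWildManinUnit` (stmt-BirchSwinnertonDyer-24306) ⟸ CDT THEOREM 1** (all clauses idle). CONDITIONAL; the item is not closed by this;
BSD is not proved by this. [cite: CalegariDimitrovTang2025, Thm. 1] -/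
theorem kummerCornerWildManinUnit_of_CDTInt (hCDT : CalegariDimitrovTang2025_unboundedDenominators) :
    KummerCornerWildManinUnit := by
  intro W _ _ p _ _ D hcell hadd _hirr _hord _htor _hwild hlat
  have hp5 : 5 ≤ p := by rcases hcell with ⟨rfl, _⟩ | ⟨rfl, _⟩ <;> omega
  exact not_dvd_c_of_CDTInt hCDT D hp5 hadd hlat

/-- **TAME `KummerCornerTameManinUnit` (stmt-BirchSwinnertonDyer-24307) ⟸ CDT THEOREM 1** (all clauses idle). CONDITIONAL; the item is not closed by this;
BSD is not proved by this. [cite: CalegariDimitrovTang2025, Thm. 1] [cite: AgasheRibetStein2006, Thm. 2.7] -/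
theorem kummerCornerTameManinUnit_of_CDTInt (hCDT : CalegariDimitrovTang2025_unboundedDenominators) :
    KummerCornerTameManinUnit := by
  intro W _ _ p _ _ D hcell hadd _hirr _hord _htor _htame hlat
  have hp5 : 5 ≤ p := by rcases hcell with ⟨rfl, _⟩ | ⟨rfl, _⟩ <;> omega
  exact not_dvd_c_of_CDTInt hCDT D hp5 hadd hlat

/-- **GE11 `OrdinaryLowValuationOptimalManinUnitGeEleven` (stmt-BirchSwinnertonDyer-23885) ⟸ CDT THEOREM 1** (Edixhoven's own exceptional case; all clauses
idle). CONDITIONAL; the item is not closed by this; BSD is not proved by this. [cite: CalegariDimitrovTang2025, Thm. 1] [cite: EdixhovenManin1991, Thm. 3 (the exception)] -/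
theorem ordinaryLowValuationOptimalManinUnitGeEleven_of_CDTInt (hCDT : CalegariDimitrovTang2025_unboundedDenominators) :
    OrdinaryLowValuationOptimalManinUnitGeEleven := by
  intro W _ _ p _ _ D h11 hadd _hirr _hord _hv hlat
  exact not_dvd_c_of_CDTInt hCDT D (by omega) hadd hlat

/-- **All SEVEN Manin-side declarations of the route MODULO CDT THEOREM 1 ALONE** (same conjunction and order as `TeichmullerTwistDescent.maninSide_of_CDT`
and as the closed conditional-record item `ManinSideOfCDT` stmt-BirchSwinnertonDyer-32257, whose antecedent is the `_algInt` reading): the Theorem-1 twin,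
strictly stronger. CONDITIONAL on the single cite-only printed fact `hCDT`; nothing closed; Manin's conjecture and BSD are not proved by this.
[cite: CalegariDimitrovTang2025, Thm. 1] -/
theorem maninSide_of_CDTInt (hCDT : CalegariDimitrovTang2025_unboundedDenominators) :
    PrincipalSeriesOptimalManinUnit ∧ SupercuspidalOptimalManinUnitFiveSeven ∧
      KummerCornerTorsionOptimalManinUnit ∧ SupersingularTorsionOptimalManinUnitFive ∧
      KummerCornerWildManinUnit ∧ KummerCornerTameManinUnit ∧ OrdinaryLowValuationOptimalManinUnitGeEleven :=
  ⟨principalSeriesOptimalManinUnit_of_CDTInt hCDT, supercuspidalOptimalManinUnitFiveSeven_of_CDTInt hCDT,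
    kummerCornerTorsionOptimalManinUnit_of_CDTInt hCDT, supersingularTorsionOptimalManinUnitFive_of_CDTInt hCDT,
    kummerCornerWildManinUnit_of_CDTInt hCDT, kummerCornerTameManinUnit_of_CDTInt hCDT,
    ordinaryLowValuationOptimalManinUnitGeEleven_of_CDTInt hCDT⟩

/-- **The closed record `ManinSideOfCDT` (stmt-BirchSwinnertonDyer-32257: `_algInt → seven decls`) THROUGH the Theorem-1 closer** — so the Theorem-1 key is the
weaker (better) hypothesis; recorded for bookkeeping only. [cite: CalegariDimitrovTang2025, Thm. 1 and Remark 58] -/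
theorem maninSideOfCDT_of_CDTInt : ManinSideOfCDT :=
  fun h ↦ maninSide_of_CDTInt (CalegariDimitrovTang2025_unboundedDenominators_of_algInt h)

end Summit.BirchSwinnertonDyer.BirchSwinnertonDyer.Theorems.TeichmullerTwistDescentOfCDTInt

end
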